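import Summits.HubbardSuperconductivity.HubbardSuperconductivity.Theorems.BalabanIRBirBdGPhaseCoercivityNambu
import HarnessLib

/-!
# Crux `BirBdGPhaseCoercivity` (stmt-HubbardSuperconductivity-2081, route `BalabanIR`), line
`bcs-dual-persistence` (reshaped, `V := K`) — stub `stub_refTraceNorm` (S3, trace norm of the reference)

In the plane-wave basis the reference BdG matrix is `X̂₀ = [[ξ, Δ], [conj Δ, -ξ]]` with DIAGONAL blocks;
with `E_k = √(ξ_k² + |Δ_k|²) > 0` and `𝔼 = E ⊕ E` one has `X̂₀² = 𝔼²`, `[X̂₀, 𝔼] = 0`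
(`BirBdG.nambuHat_sq`, `BirBdG.nambuHat_comm`) and `𝔼 𝔼⁻¹ = 1` (`BirBdG.nambuMetricHat_mul_inv`), so
`V := X̂₀ 𝔼⁻¹` is unitary and the duality minorant `re_trace_mul_unitary_le_sum_abs_eigenvalues` gives
`Σ|λ(X̂₀)| ≥ Re Tr (X̂₀ V) = Re Tr 𝔼 = 2 Σ_k E_k`. (Compare the proof of `half_re_trace_metric_deficit_le`.)
No definition is introduced. [folklore]
-/

noncomputable section

set_option linter.dupNamespace false

namespace Summit.HubbardSuperconductivity.HubbardSuperconductivity.Theorems.BirBdGPhaseCoercivity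

open Matrix Finset Summit.HubbardSuperconductivity.HubbardSuperconductivity.Theorems.BirBdG
open scoped ComplexConjugate ComplexOrder

/-- **Unitary minorant at `V = X₀ K`.** If `X₀` is Hermitian, `K` is self-adjoint, `M² = X₀²` and
`M K = 1`, then `Re Tr M ≤ Σ_i |λ_i(X₀)|`: `V = X₀ K` is unitary (`V⋆ V = K X₀² K = K M² K = 1`) and
`Tr (X₀ V) = Tr (M² K) = Tr M`. [folklore] -/
private theorem re_trace_le_sum_abs_eigenvalues_of_sq {n : Type*} [Fintype n] [DecidableEq n]
    (X₀ M K : Matrix n n ℂ) (hX₀ : X₀.IsHermitian) (hK : Kᴴ = K) (hsq : M * M = X₀ * X₀)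
    (hMK : M * K = 1) : M.trace.re ≤ ∑ i, |hX₀.eigenvalues i| := by
  have hKM : K * M = 1 := mul_eq_one_comm.1 hMK
  have hV : X₀ * K ∈ Matrix.unitaryGroup n ℂ := by
    rw [Matrix.mem_unitaryGroup_iff', star_eq_conjTranspose, Matrix.conjTranspose_mul, hK, hX₀.eq]
    calc K * X₀ * (X₀ * K) = K * (X₀ * X₀) * K := by simp only [Matrix.mul_assoc]
      _ = K * (M * M) * K := by rw [hsq]
      _ = 1 := by rw [← Matrix.mul_assoc, hKM, Matrix.one_mul, hMK]
  have hlow := re_trace_mul_unitary_le_sum_abs_eigenvalues X₀ (X₀ * K) hX₀ hV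
  have htrV : (X₀ * (X₀ * K)).trace = M.trace := by
    rw [← Matrix.mul_assoc, ← hsq, Matrix.mul_assoc, hMK, Matrix.mul_one]
  rw [htrV] at hlow
  exact hlow

/-- **Trace norm of the BdG reference**: `2 Σ_k E_k ≤ Σ_i |λ_i(X̂₀)|` for `X̂₀ = [[ξ, Δ], [conj Δ, -ξ]]`
(diagonal blocks), `E = √(ξ² + |Δ|²) > 0`. [folklore] -/
theorem stub_refTraceNorm {m : Type*} [Fintype m] [DecidableEq m] (ξ E : m → ℝ) (Δ : m → ℂ)
    (hEpos : ∀ k, 0 < E k) (hE : ∀ k, E k ^ 2 = ξ k ^ 2 + ‖Δ k‖ ^ 2)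
    (hX₀ : (Matrix.fromBlocks (diagonal fun k => (ξ k : ℂ)) (diagonal Δ) (diagonal Δ)ᴴ
      (-diagonal fun k => (ξ k : ℂ))).IsHermitian) :
    2 * ∑ k, E k ≤ ∑ i, |hX₀.eigenvalues i| := by
  have hEne : ∀ k, E k ≠ 0 := fun k => (hEpos k).ne'
  -- `𝔼⁻¹ = E⁻¹ ⊕ E⁻¹` is self-adjoint
  have hstar : star (fun k => ((E k)⁻¹ : ℂ)) = fun k => ((E k)⁻¹ : ℂ) := by
    funext k
    simp
  have hK : (Matrix.fromBlocks (diagonal fun k => ((E k)⁻¹ : ℂ)) 0 0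
      (diagonal fun k => ((E k)⁻¹ : ℂ)) : Matrix (m ⊕ m) (m ⊕ m) ℂ)ᴴ =
      Matrix.fromBlocks (diagonal fun k => ((E k)⁻¹ : ℂ)) 0 0 (diagonal fun k => ((E k)⁻¹ : ℂ)) := by
    rw [Matrix.fromBlocks_conjTranspose, Matrix.conjTranspose_zero, Matrix.diagonal_conjTranspose,
      hstar]
  -- the unitary minorant at `V = X̂₀ 𝔼⁻¹`: `Re Tr 𝔼 ≤ Σ |λ(X̂₀)|`
  have hle := re_trace_le_sum_abs_eigenvalues_of_sq _ _ _ hX₀ hK (nambuHat_sq ξ E Δ hE)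
    (nambuMetricHat_mul_inv E hEne)
  -- `Re Tr 𝔼 = 2 Σ_k E_k`
  have htrM : (Matrix.fromBlocks (diagonal fun k => (E k : ℂ)) 0 0 (diagonal fun k => (E k : ℂ)) :
      Matrix (m ⊕ m) (m ⊕ m) ℂ).trace = 2 * ∑ k, (E k : ℂ) := by
    rw [show ∀ (A B C D : Matrix m m ℂ), (Matrix.fromBlocks A B C D).trace = A.trace + D.trace from
      fun A B C D => by simp [Matrix.trace, Fintype.sum_sum_type]]
    rw [Matrix.trace_diagonal, two_mul]
  have hre : (Matrix.fromBlocks (diagonal fun k => (E k : ℂ)) 0 0 (diagonal fun k => (E k : ℂ)) :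
      Matrix (m ⊕ m) (m ⊕ m) ℂ).trace.re = 2 * ∑ k, E k := by
    rw [htrM, show (2 * ∑ k, (E k : ℂ)) = ((2 * ∑ k, E k : ℝ) : ℂ) by push_cast; rfl,
      Complex.ofReal_re]
  rw [hre] at hle
  exact hle

end Summit.HubbardSuperconductivity.HubbardSuperconductivity.Theorems.BirBdGPhaseCoercivity

end
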